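import Literature.Algebra.Homology.EulerCharacteristicShift
import Literature.Algebra.Homology.HomologyEulerCharacteristicShortExact
import Mathlib.Algebra.Homology.HomotopyCategory.DegreewiseSplit
import Mathlib.Algebra.Homology.HomologicalComplexAbelian
import HarnessLib

/-!
# The Euler characteristic of a mapping cone: `χ(cone φ) = χ(G) − χ(F)`

Layer `Literature/Algebra/Homology` (pure linear algebra over Mathlib; proved theorems only, 0 definitions, 0 named
facts, no instances, no notation). For a morphism `φ : F ⟶ G` of cochain complexes of vector spaces over a division ring
(Mathlib `CochainComplex (ModuleCat K) ℤ`, `CochainComplex.mappingCone φ`):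

* `shortExact_triangleRotateShortComplex` — Mathlib's degreewise-split rotated triangle
  `G ⟶ cone φ ⟶ F⟦1⟧` (`CochainComplex.mappingCone.triangleRotateShortComplex φ`, splittings
  `triangleRotateShortComplexSplitting`) is a short exact sequence of complexes (`shortExact_of_degreewise_shortExact`);
* **`eulerChar_mappingCone : (mappingCone φ).eulerChar = G.eulerChar − F.eulerChar`** when `F`, `G` are degreewise
  finite-dimensional with finitely many non-zero terms (row `EulerCharacteristicShortExact.eulerChar_X₂_eq_add` on that
  sequence, then `EulerCharShift.eulerChar_shift F 1` and `Int.negOnePow_one`);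
* **`homologyEulerChar_mappingCone : (mappingCone φ).homologyEulerChar = G.homologyEulerChar − F.homologyEulerChar`** when the
  COHOMOLOGY of `F`, `G` is finite-dimensional with finite support (row
  `HomologyEulerCharacteristicShortExact.homologyEulerChar_X₂_eq_add` — the long exact sequence of the cone — then
  `EulerCharShift.homologyEulerChar_shift F 1`);
* `homologyEulerChar_mappingCone_eq_zero_of_quasiIso` (under those hypotheses the cone of a quasi-isomorphism has
  `χ_H = 0`), and `homologyEulerChar_eq_of_homotopyEquiv` (homotopy equivalent complexes, any shape, have the same `χ_H`).

Mathlib (pin v4.32) has no cone or homotopy lemma for its `eulerChar` (`lean search 'eulerChar'`: the defining file only);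
`Mathlib.Algebra.Homology.HomologicalComplexAbelian` is imported for `HomologicalComplex.shortExact_of_degreewise_shortExact`.
Library only (cell `pub-hodge-ring2`, count-neutral); proves nothing about any crux, route or conjecture.

## References

* S. Lang, *Algebra* (2002), Ch. XX §3 (Euler characteristic and the Grothendieck group; additivity on exact triangles). [Lang2002]
* U. Görtz, T. Wedhorn, *Algebraic Geometry II* (2023), Remark 23.62 (2) (`χ` is additive on distinguished triangles of `D^b`). [GortzWedhorn2023]
-/

open CategoryTheory CategoryTheory.Limits CochainComplex

universe v u

namespace Literature.Algebra.Homology.EulerCharMappingCone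

variable {K : Type u} [DivisionRing K] {F G : CochainComplex (ModuleCat.{v} K) ℤ} (φ : F ⟶ G)

/-- Mathlib's rotated standard triangle `G ⟶ cone φ ⟶ F⟦1⟧` of a morphism of cochain complexes is a (degreewise split,
hence) short exact sequence of complexes. [cite: Lang2002, XX §3] -/
theorem shortExact_triangleRotateShortComplex : (mappingCone.triangleRotateShortComplex φ).ShortExact :=
  HomologicalComplex.shortExact_of_degreewise_shortExact _ fun n =>
    (mappingCone.triangleRotateShortComplexSplitting φ n).shortExact

/-! ### `χ` of the cone -/

/-- **`χ(cone φ) = χ(G) − χ(F)`** for Mathlib's `HomologicalComplex.eulerChar`, when `F` and `G` are degreewise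
finite-dimensional with finitely many non-zero terms. [cite: Lang2002, XX §3] [cite: GortzWedhorn2023, Remark 23.62 (2)] -/
theorem eulerChar_mappingCone [∀ i, Module.Finite K (F.X i)] [∀ i, Module.Finite K (G.X i)]
    (hF : (GradedObject.finrankSupport F.X).Finite) (hG : (GradedObject.finrankSupport G.X).Finite) :
    (mappingCone φ).eulerChar = G.eulerChar - F.eulerChar := by
  haveI : ∀ i, Module.Finite K ((mappingCone.triangleRotateShortComplex φ).X₁.X i) :=
    fun i => inferInstanceAs (Module.Finite K (G.X i))
  haveI : ∀ i, Module.Finite K ((mappingCone.triangleRotateShortComplex φ).X₃.X i) :=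
    fun i => EulerCharShift.moduleFinite_shift_X F 1 i
  have h := EulerCharShortExact.eulerChar_X₂_eq_add (shortExact_triangleRotateShortComplex φ) hG
    (EulerCharShift.finrankSupport_shift_X_finite F 1 hF)
  have h1 : ((mappingCone.triangleRotateShortComplex φ).X₃).eulerChar = -F.eulerChar := by
    change (F⟦(1 : ℤ)⟧).eulerChar = _
    rw [EulerCharShift.eulerChar_shift, Int.negOnePow_one, Units.val_neg, Units.val_one, neg_one_mul]
  rw [h1] at h
  change (mappingCone φ).eulerChar = G.eulerChar + -F.eulerChar at h
  rw [h, sub_eq_add_neg]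

/-! ### `χ_H` of the cone -/

/-- **`χ_H(cone φ) = χ_H(G) − χ_H(F)`** for Mathlib's `HomologicalComplex.homologyEulerChar`, when the cohomology of
`F` and of `G` is finite-dimensional in each degree and non-zero in finitely many (the long exact cohomology sequence of
the cone). [cite: Lang2002, XX §3] [cite: GortzWedhorn2023, Remark 23.62 (2)] -/
theorem homologyEulerChar_mappingCone [∀ i, Module.Finite K (F.homology i)] [∀ i, Module.Finite K (G.homology i)]
    (hF : (GradedObject.finrankSupport fun i => F.homology i).Finite)
    (hG : (GradedObject.finrankSupport fun i => G.homology i).Finite) :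
    (mappingCone φ).homologyEulerChar = G.homologyEulerChar - F.homologyEulerChar := by
  haveI : ∀ i, Module.Finite K ((mappingCone.triangleRotateShortComplex φ).X₁.homology i) :=
    fun i => inferInstanceAs (Module.Finite K (G.homology i))
  haveI : ∀ i, Module.Finite K ((mappingCone.triangleRotateShortComplex φ).X₃.homology i) :=
    fun i => EulerCharShift.moduleFinite_shift_homology F 1 i
  have h := EulerCharShortExact.homologyEulerChar_X₂_eq_add (shortExact_triangleRotateShortComplex φ) hG
    (EulerCharShift.finrankSupport_shift_homology_finite F 1 hF)
  have h1 : ((mappingCone.triangleRotateShortComplex φ).X₃).homologyEulerChar = -F.homologyEulerChar := by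
    change (F⟦(1 : ℤ)⟧).homologyEulerChar = _
    rw [EulerCharShift.homologyEulerChar_shift, Int.negOnePow_one, Units.val_neg, Units.val_one, neg_one_mul]
  rw [h1] at h
  change (mappingCone φ).homologyEulerChar = G.homologyEulerChar + -F.homologyEulerChar at h
  rw [h, sub_eq_add_neg]

/-- The cone of a quasi-isomorphism between complexes with finite-dimensional, finitely supported cohomology has
`χ_H = 0`. [cite: Lang2002, XX §3] -/
theorem homologyEulerChar_mappingCone_eq_zero_of_quasiIso [QuasiIso φ] [∀ i, Module.Finite K (F.homology i)]
    [∀ i, Module.Finite K (G.homology i)] (hF : (GradedObject.finrankSupport fun i => F.homology i).Finite)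
    (hG : (GradedObject.finrankSupport fun i => G.homology i).Finite) :
    (mappingCone φ).homologyEulerChar = 0 := by
  rw [homologyEulerChar_mappingCone φ hF hG, EulerCharShortExact.homologyEulerChar_eq_of_quasiIso φ, sub_self]

/-- **Homotopy equivalent complexes have the same homological Euler characteristic** (any shape).
[cite: Lang2002, XX §3] -/
theorem homologyEulerChar_eq_of_homotopyEquiv {ι : Type*} {c : ComplexShape ι} [c.EulerCharSigns]
    {C D : HomologicalComplex (ModuleCat.{v} K) c} (e : HomotopyEquiv C D) :
    C.homologyEulerChar = D.homologyEulerChar :=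
  EulerCharShortExact.homologyEulerChar_eq_of_quasiIso e.hom

end Literature.Algebra.Homology.EulerCharMappingCone
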